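import Summits.ResolutionOfSingularities.ResolutionOfSingularities.Theorems.WeightedInvariantIota3IsoSuccBelow
import Summits.ResolutionOfSingularities.ResolutionOfSingularities.Theorems.WeightedInvariantWeightedConstructionFormalChartAlgebra
import Summits.ResolutionOfSingularities.ResolutionOfSingularities.Theorems.WeightedInvariantWeightedConstructionExtReesWeighted
import Mathlib.RingTheory.Ideal.KrullsHeightTheorem
import HarnessLib

/-!
# Point moves VI: the local dimension of a `t`-homogeneous successor is at most the dimension of the start
# (door `HypersurfaceCentreConstruction`, stmt-ResolutionOfSingularities-19897; stub `stub_keyRungGrHomLE_three`, residual (D-b³-point-STAT-ISO))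

Topic: `Summits/ResolutionOfSingularities/ResolutionOfSingularities/Theorems`.  DEF-FREE.  Helper `--supports stmt-ResolutionOfSingularities-19897`.

The isolated-position toolkit of …CurveFracTieZeroSigmaReduction (`iotaOrdEpsTau_eq_of_isIsolatedPosition`, `iotaCylinder_eq_iotaSigma_of_isIsolated`)
reads `ι₀ = (ν ; 0 ; 0)` and the `σ`-cylinder pointwise at a regular local ring of Krull dimension `≤ 3`.  The successor rings `B_𝔫` of the door's
moves ARE regular (tree: `isRegularLocalRing_localization_cobordantAlgebra'`, …HypersurfaceLocalGameEFTSuccessorRegular); this file supplies the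
DIMENSION BOUND at the `t`-homogeneous successors of a point centre:

* **`LocalGameEFTPointMove.ringKrullDim_localization_le_of_isTHomogeneous`** — `S` regular local with minimal system `u : Fin d → S` (`(u) = 𝔪`,
  `spanFinrank 𝔪 = d`), positive weights, `B = S[t⁻¹, 𝒥ₙtⁿ]`; at every `t`-HOMOGENEOUS prime `𝔫 ∋ t⁻¹` off the vertex:
  `ringKrullDim B_𝔫 ≤ d`.  Proof: `dim B_𝔫 = ht 𝔫 ≤ ht(𝔫 ⧸ (t⁻¹)) + 1` (Krull, Mathlib `Ideal.height_le_height_add_one_of_mem`),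
  `B ⧸ (t⁻¹) ≅ κ[X₁,…,X_d]` (`ρ`), and `ht ρ(𝔫) + 1 ≤ ht 𝔐 ≤ d` because `ρ(𝔫) < (X) ≤ 𝔐` (…IsoSuccBelow `map_rho_le_span_X_of_isTHomogeneous`,
  `not_span_X_le_nbar`).
* `height_map_mk_eq_height_nbar` — `ht (𝔫.map (mk (t⁻¹))) = ht ρ(𝔫)` (transport along `B ⧸ (t⁻¹) ≃ κ[X]`).

So at the door (`d = 3`) every `t`-homogeneous successor ring over the closed point has Krull dimension `≤ 3`, and (D-b³-point-STAT-ISO) of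
…KeyRungThreeOfDropPointIso is literally the pointwise `σ`-comparison at isolated positions.

[OURS · L1 W4.3 · folklore dimension bookkeeping; AI work, weaker than expert review; nothing here is a statement of the manuscript under review
(Hironaka 2017, [claim: Hironaka2017, status: under-review]).]

## References

* J. Włodarczyk, *Functorial resolution by torus actions*, arXiv:2203.03090, §2.3.9. [Wlodarczyk2022]
* H. Matsumura, *Commutative Ring Theory*, CUP 1986, Thm. 13.5 (Krull). [Matsumura1987]
-/

noncomputable section

open IsLocalRing Literature.AlgebraicGeometry.Resolution
open Summit.ResolutionOfSingularities.ResolutionOfSingularities.Cruxes.HypersurfaceCentreConstruction.LocalEngine (IsTHomogeneous)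

set_option linter.dupNamespace false -- mandated namespace of this single-conjunct summit

namespace Summit.ResolutionOfSingularities.ResolutionOfSingularities.Theorems

namespace LocalGameEFTPointMove

variable {S : Type} [CommRing S] [IsRegularLocalRing S] {d : ℕ} (u : Fin d → S) (w : Fin d → ℕ)
  (hu : Ideal.span (Set.range u) = maximalIdeal S) (hd : (maximalIdeal S).spanFinrank = d) (hw : ∀ i, 0 < w i)

include hu hd hw in
/-- **Transport of heights along `B ⧸ (t⁻¹) ≃ κ[X]`**: `ht (𝔫 ⧸ (t⁻¹)) = ht ρ(𝔫)`. [folklore] -/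
theorem height_map_mk_eq_height_nbar (𝔫 : Ideal (extReesAlgebra (weightedMonomialIdeal u w))) :
    (𝔫.map (Ideal.Quotient.mk (Ideal.span {extReesAlgebra.tInv (weightedMonomialIdeal u w)}))).height =
      (nbar u w hu hd hw 𝔫).height := by
  -- `e : B ⧸ (t⁻¹) ≃ κ[X]` with `e ∘ mk = ρ`
  let e : (extReesAlgebra (weightedMonomialIdeal u w) ⧸ Ideal.span {extReesAlgebra.tInv (weightedMonomialIdeal u w)}) ≃+*
      MvPolynomial (Fin d) (S ⧸ Ideal.span (Set.range u)) :=
    (Ideal.quotEquivOfEq (ker_rho u w hu hd hw).symm).trans (RingHom.quotientKerEquivOfSurjective (rho_surjective u w hu hd hw))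
  have he : ∀ b, e (Ideal.Quotient.mk _ b) = rho u w hu hd hw b := fun b => by
    simp [e, RingHom.quotientKerEquivOfSurjective_apply_mk]
  have he' : e.toRingHom.comp (Ideal.Quotient.mk (Ideal.span {extReesAlgebra.tInv (weightedMonomialIdeal u w)})) =
      rho u w hu hd hw := RingHom.ext he
  have hmap : (𝔫.map (Ideal.Quotient.mk (Ideal.span {extReesAlgebra.tInv (weightedMonomialIdeal u w)}))).map e =
      nbar u w hu hd hw 𝔫 := by
    change _ = 𝔫.map (rho u w hu hd hw)
    rw [← he', ← Ideal.map_map]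
    rfl
  have h := RingEquiv.height_map e (𝔫.map (Ideal.Quotient.mk (Ideal.span {extReesAlgebra.tInv (weightedMonomialIdeal u w)})))
  rw [hmap] at h
  exact h.symm

include hu hd hw in
/-- **`dim B_𝔫 ≤ d` at every `t`-homogeneous off-vertex prime `𝔫 ∋ t⁻¹`** (point centre `(u) = 𝔪` in a regular local ring with minimal system
`u : Fin d → S`, positive weights). [folklore · OUR bookkeeping for (D-b³-point-STAT-ISO)] [cite: Matsumura1987, Thm. 13.5] -/
theorem ringKrullDim_localization_le_of_isTHomogeneous (𝔫 : Ideal (extReesAlgebra (weightedMonomialIdeal u w))) [𝔫.IsPrime]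
    (hT : extReesAlgebra.tInv (weightedMonomialIdeal u w) ∈ 𝔫) (hhom : IsTHomogeneous u w 𝔫)
    (hV : ¬ extReesAlgebra.vertexIdeal (weightedMonomialIdeal u w) ≤ 𝔫) :
    ringKrullDim (Localization.AtPrime 𝔫) ≤ d := by
  haveI : (Ideal.span (Set.range u)).IsMaximal := by rw [hu]; exact IsLocalRing.maximalIdeal.isMaximal S
  letI : Field (S ⧸ Ideal.span (Set.range u)) := Ideal.Quotient.field _
  haveI := isDomain_of_isRegularLocalRing S
  haveI : IsNoetherianRing (extReesAlgebra (weightedMonomialIdeal u w)) :=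
    isNoetherianRing_extReesAlgebra (stub_extReesAlgebra_weighted u w)
  haveI := nbar_isPrime u w hu hd hw 𝔫 hT
  -- `dim B_𝔫 = ht 𝔫 ≤ ht (𝔫 ⧸ t⁻¹) + 1 = ht ρ(𝔫) + 1`
  rw [IsLocalization.AtPrime.ringKrullDim_eq_height 𝔫 (Localization.AtPrime 𝔫)]
  have h1 := Ideal.height_le_height_add_one_of_mem hT
  rw [height_map_mk_eq_height_nbar u w hu hd hw 𝔫] at h1
  -- `ht ρ(𝔫) + 1 ≤ ht 𝔐 ≤ d` for a maximal `𝔐 ⊇ (X) > ρ(𝔫)`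
  obtain ⟨M, hM, hXM⟩ := Ideal.exists_le_maximal _ (span_X_ne_top u hu)
  haveI := hM.isPrime
  have hlt : nbar u w hu hd hw 𝔫 < M :=
    lt_of_lt_of_le (lt_of_le_of_ne (map_rho_le_span_X_of_isTHomogeneous u w hu hd hw 𝔫 Ideal.IsPrime.ne_top' hhom)
      fun h => not_span_X_le_nbar u w hu hd hw 𝔫 hT hV h.ge) hXM
  have h2 := Ideal.height_add_one_le_of_lt_of_isPrime hlt
  have hdim : ringKrullDim (MvPolynomial (Fin d) (S ⧸ Ideal.span (Set.range u))) = (d : WithBot ℕ∞) := by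
    rw [MvPolynomial.ringKrullDim_of_isNoetherianRing, ringKrullDim_eq_zero_of_field, zero_add, Nat.card_eq_fintype_card, Fintype.card_fin]
  have h3 : M.height ≤ (d : ℕ∞) := by
    have := Ideal.height_le_ringKrullDim_of_isPrime (I := M)
    rw [hdim, ← WithBot.coe_natCast, WithBot.coe_le_coe] at this
    exact this
  have h4 : 𝔫.height ≤ (d : ℕ∞) := h1.trans (h2.trans h3)
  rw [← WithBot.coe_natCast]
  exact_mod_cast h4

end LocalGameEFTPointMove

end Summit.ResolutionOfSingularities.ResolutionOfSingularities.Theorems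

end
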